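import Summits.QuantumFields.YangMills.Theorems.FemtoTransferGapRungW1upProfiles

/-!
# The IMS phase of the one-site crux: `Θ_ℓ(U) = (π/2)·(1 − Π_e clamp01(2 − vacDist(U_e)/ℓ))` (DEFINITION)
# (objects posited by the line `energy-lower-abs` of crux `OneSiteLevels`, route `LuscherReduction`, item stmt-QuantumFields-20007;
# fleet lead prover ym-luscher-20007-p1)

The composition seam `absUpper_of_localized` (`Theorems/LuscherReductionOneSiteLevelsAbsUpperSeam.lean`) reduces the registered stub
`stub_absUpper` to an INNER and an OUTER bound stated for the angular partition `cos Θ_B`, `sin Θ_B` of ONE fixed family of phases.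
This file fixes that family: at link scale `ℓ > 0`,

  `onePhase ℓ U = (π/2) · (1 − Π_{e : Edge 3 1} clamp01 (2 − vacDist (U e) / ℓ))`,

with `vacDist W = min(‖W − 1‖_F, ‖W + 1‖_F)` the twist-invariant distance of a link to the centre `{±1}` and `clamp01` the unit ramp (both from
the W1-up chain).  So `Θ = 0` (pure `cos`-piece: INNER) when every link is within `ℓ` of `±1`, `Θ = π/2` (pure `sin`-piece: OUTER) as soon as
one link is at distance `≥ 2ℓ`; and `onePhaseScale B = √λ_b(B)` is the scale at which the IMS error is `O(λ_b²)` (line card (I3)).  Properties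
(measurability, gauge/twist invariance, link-Lipschitz constant `π/(2ℓ)`, support) are proved in `Theorems/LuscherReductionOneSiteLevelsPhase.lean`.
-/

set_option autoImplicit false

noncomputable section

open scoped BigOperators
open Literature.MathematicalPhysics.QuantumFieldTheory
open Literature.MathematicalPhysics.QuantumLattice

namespace Summit.QuantumFields.YangMills.Theorems.FemtoTransferGap

/-- **The IMS phase at link scale `ℓ`**: `Θ_ℓ(U) = (π/2)(1 − Π_e clamp01(2 − vacDist(U_e)/ℓ))` — `0` on the union of the toron balls
`{∀ e, vacDist(U_e) ≤ ℓ}`, `π/2` off `{∀ e, vacDist(U_e) < 2ℓ}`, link-Lipschitz with constant `π/(2ℓ)` in between.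
[cite: SimonB1983DiscreteSpectrum, §3] -/
def onePhase (ℓ : ℝ) (U : Cfg) : ℝ :=
  Real.pi / 2 * (1 - ∏ e : Edge 3 1, clamp01 (2 - vacDist (U e) / ℓ))

/-- **The IMS scale of the crux**: `ℓ(B) = √λ_b(B)` (link angle `≍ λ_b^{1/2}`, i.e. `|x| ≍ λ_b^{−1/2}` in `𝔥`-units), at which the IMS
error `≍ linkCE/(Bℓ²)` is `O(λ_b²)·linkCE`. [cite: SimonB1983DiscreteSpectrum, §3] -/
def onePhaseScale (B : ℝ) : ℝ := Real.sqrt (bareLambda B)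

end Summit.QuantumFields.YangMills.Theorems.FemtoTransferGap

end
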